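import Mathlib
import Literature.AlgebraicGeometry.Tropical.TorusCycles
import Summits.HodgeConjecture.HodgeConjecture.Theses.TropicalWeilObstruction
import Summits.HodgeConjecture.HodgeConjecture.Theorems.TropicalWeilObstructionTropicalWeilVanishingTransportPhase
import Summits.HodgeConjecture.HodgeConjecture.Theorems.TropicalWeilObstructionTropicalWeilVanishingCalibrationTwoPhases
import Summits.HodgeConjecture.HodgeConjecture.Theorems.TropicalWeilObstructionTropicalWeilVanishingCalibrationCone
import Summits.HodgeConjecture.HodgeConjecture.Theorems.TropicalWeilObstructionTropicalHodgeBoundRationalHodgeCoordinates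
import HarnessLib

/-!
# Crux `TropicalWeilVanishing` (stmt-HodgeConjecture-18478) — ONE effective cycle with `W ≠ 0` gives THREE
# effective cycles with linearly independent classes on the same eightfold; K1 ⟺ "no three independent
# effective tropical (4,4)-classes"

Route `TropicalWeilObstruction` of `HodgeConjecture`; cell `pub-hodge-tropical` (Hodge NEGATION SINK — Kontsevich's
tropical test; scoped exploration, cap 2 seats, no summit claim), seat tropical-1 gen 15
(`prover-pub-hodge-tropical-1-g15-0`, 2026-08-23). HONEST FRAMING: structural bookkeeping about the crux K1
(`TropicalWeilVanishing`, OPEN, open problem); it decides nothing about K1 and nothing here bears on the Hodge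
conjecture. negation-sink work.

WHAT. The scalar isogeny `k = 2 + J` is an endomorphism of EVERY tropical Weil torus `ℝ⁸/Q·ℤ⁸` (`QJ = JQ`), and the
push-forward `k_*` of an effective tropical 4-cycle is effective with `W(k_*Z) = (2+i)⁸·W(Z) = (−527 − 336i)·W(Z)`
and `μ(k_*Z) = 625·μ(Z)` (the tree's `Phases.exists_endomorphism_transport`, p363800). Since `(2+i)⁸/625` is NOT
real, the two linear functionals `Ŵ = dz ⊗ dz` and `M̂ = dz ⊗ dz̄` of the K3 files separate the three classes
`[Z], [k_*Z], [k_*k_*Z]` as soon as `W(Z) ≠ 0`: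

* `linearIndependent_cyc_of_isogenyTower` — effective cycles with `(W, μ)`, `(λW, 625μ)`, `(λ²W, 625²μ)`,
  `λ = −527 − 336i`, `W ≠ 0`, have ℝ-linearly independent cycle classes (a real relation gives
  `g₀ + λg₁ + λ²g₂ = 0` and `g₀ + 625g₁ + 625²g₂ = 0`, whose only real solution is `0`);
* `exists_three_linearIndependent_cyc_of_weilFunctional_ne_zero` — at ANY `Q` with `QJ = JQ` (no positivity, no
  genericity): one effective tropical 4-cycle with `W ≠ 0` yields three effective tropical 4-cycles on the same torus
  with ℝ- (hence ℚ-) linearly independent classes. (At `n = 4` the endomorphism `1 + J` is useless here: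
  `(1+i)⁸ = 16` is real — `one_add_I_pow_eight`; `2 + J` is the first scalar isogeny that rotates the Weil plane.)
* `tropicalWeilVanishing_iff_no_three_linearIndependent` — **K1 ⟺ for every very general tropical Weil eightfold,
  NO three effective tropical 4-cycles have ℚ-linearly independent classes.** (⟹ is K1 together with the PROVED crux
  K3 `TropicalHodgeBound` (p322554: three cycles with `W = 0` are dependent); ⟸ is the theorem above.)

WHY IT IS WORTH RECORDING. (1) The route's assembly consumes K1 only through "K2 casts THREE ℚ-independent
effective classes, K1 + K3 forbid them"; the weakest tropical statement that could replace K1 there is exactly the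
right-hand side of the `iff` — so nothing is lost by the crux being K1: "the very general tropical Weil eightfold
carries fewer than three independent effective (4,4)-classes" IS K1. (2) With K3's coordinates (every effective class
lies in `⟨θ₄, Re w, Im w⟩_ℚ`, rank 3) the number `N(Q)` of ℚ-independent effective classes (the quantity of the
cell's `K2-SIZE.md` §2, there recorded as `N(Q) ∈ {1,2,3}`) satisfies the DICHOTOMY `N(Q) ∈ {1, 3}` at every
Weil-generic period, `N(Q) = 1 ⟺` K1 holds at `Q`: the tropical mirror of the classical dichotomy `M(A) ∈ {1,3}`
for Mumford–Tate-generic Weil eightfolds (`K2-SIZE.md` §2, via the correspondence `(2·1 + φ)^*` with eigenvalues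
`625, −527 ∓ 336i` — the same numbers). (3) Combined with the cell's paper theorem "effective domination" (every
SIGNED tropical 4-cycle is the difference of two effective ones, HOME `certificates/signedcycles/`), `N(Q)` is the
rank of Mikhalkin–Zharkov's straight homology `H^{straight}_{4,4}(X_Q)` [MikhalkinZharkov2014Eigenwave, Def. 4.4],
and K1 is verbatim the failure of their tropical Hodge conjecture for the Weil classes at `g = 8`.

Mathlib + tree lemmas only; nothing is defined; no named fact; no sorry.

## References

* [Zharkov2020TropicalWeil] I. Zharkov, Tropical abelian varieties, Weil classes and the Hodge conjecture,
  arXiv:2002.02347 (2020), pp. 1–3 (straight/algebraic tropical cycles, the classes `θ, w₁, w₂`, Kontsevich's scheme).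
* [MikhalkinZharkov2014Eigenwave] G. Mikhalkin, I. Zharkov, Tropical eigenwave and intermediate Jacobians,
  LN UMI 15 (2014), Def. 4.2, Prop. 4.3, Def. 4.4, Thm. 5.4.
-/

-- `Summit.HodgeConjecture.HodgeConjecture.…` is the mandated namespace (single-conjunct summit).
set_option linter.dupNamespace false

noncomputable section

open scoped BigOperators Matrix ComplexConjugate
open Matrix Literature.AlgebraicGeometry.Tropical

namespace Summit.HodgeConjecture.HodgeConjecture.Theorems.TropicalWeilVanishing.Phases

/-! ## §0 Display-only notation (verbatim bodies of the K3 / TransportPhase files; nothing is defined) -/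

/-- The hermitian mass `μ(Z)` (display-only). -/
local notation3 (prettyPrint := false) "μ⟦" n ", " Z "⟧" =>
  (∑ σ, ((TropicalTorusCycle.cell Z σ).weight : ℝ) * (TropicalTorusCycle.cell Z σ).latticeVolume *
    ‖frameComplexDet n (TropicalTorusCycle.cell Z σ).frame‖ ^ 2)

/-- The skeleton's `dzCoord n S`. -/
local notation3 (prettyPrint := false) "dz⟦" n "⟧" S:max =>
  (Matrix.det (Matrix.of fun k a : Fin n =>
    (if (S a : ℕ) = (k : ℕ) then (1 : ℂ) else 0) + (if (S a : ℕ) = (k : ℕ) + n then Complex.I else 0)))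

/-- The skeleton's `weilPairing n C` (the value `Ŵ(C)` of `dz ⊗ dz`). -/
local notation3 (prettyPrint := false) "Ŵ⟦" n "⟧" C:max =>
  (∑ S : Fin n → Fin (2 * n), ∑ S' : Fin n → Fin (2 * n),
    dz⟦n⟧ S * dz⟦n⟧ S' / ((Nat.factorial n : ℂ) ^ 2) * ((C S S' : ℝ) : ℂ))

/-- The hermitian pairing `M̂(C)` (the value of `dz ⊗ dz̄` on `C`). -/
local notation3 (prettyPrint := false) "M̂⟦" n "⟧" C:max =>
  (∑ S : Fin n → Fin (2 * n), ∑ S' : Fin n → Fin (2 * n),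
    dz⟦n⟧ S * (starRingEnd ℂ) (dz⟦n⟧ S') / ((Nat.factorial n : ℂ) ^ 2) * ((C S S' : ℝ) : ℂ))

/-! ## §1 Arithmetic of the scalar isogenies `1 + J`, `2 + J` at `n = 4` -/

/-- `(2 + i)² = 3 + 4i`. [folklore] -/
theorem two_add_I_sq : ((2 : ℂ) + (1 : ℂ) * Complex.I) ^ 2 = 3 + 4 * Complex.I := by
  have hI : Complex.I * Complex.I = -1 := Complex.I_mul_I
  linear_combination (1 : ℂ) * hI

/-- `(3 + 4i)² = −7 + 24i`. [folklore] -/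
theorem three_add_four_I_sq : ((3 : ℂ) + 4 * Complex.I) ^ 2 = -7 + 24 * Complex.I := by
  have hI : Complex.I * Complex.I = -1 := Complex.I_mul_I
  linear_combination (16 : ℂ) * hI

/-- `(−7 + 24i)² = −527 − 336i`. [folklore] -/
theorem neg_seven_add_I_sq : ((-7 : ℂ) + 24 * Complex.I) ^ 2 = -527 - 336 * Complex.I := by
  have hI : Complex.I * Complex.I = -1 := Complex.I_mul_I
  linear_combination (576 : ℂ) * hI

/-- `(2 + i)⁸ = −527 − 336i`: the factor by which the endomorphism `2 + J` of a tropical Weil EIGHTFOLD multiplies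
the Weil functional. [cite: Zharkov2020TropicalWeil, §2 (pp. 2–4)] -/
theorem two_add_I_pow_eight : ((2 : ℂ) + (1 : ℂ) * Complex.I) ^ (2 * 4) = -527 - 336 * Complex.I := by
  rw [show 2 * 4 = 2 * 2 * 2 by norm_num, pow_mul, pow_mul, two_add_I_sq, three_add_four_I_sq,
    neg_seven_add_I_sq]

/-- `(−527 − 336i)² = 164833 + 354144i`. [folklore] -/
theorem lambda_sq : ((-527 : ℂ) - 336 * Complex.I) ^ 2 = 164833 + 354144 * Complex.I := by
  have hI : Complex.I * Complex.I = -1 := Complex.I_mul_I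
  linear_combination (112896 : ℂ) * hI

/-- `(1 + i)⁸ = 16` is REAL: at `n = 4` the endomorphism `1 + J` does not rotate the Weil plane (it multiplies
`W` and `μ` by the same real factor), which is why `2 + J` is used. [cite: Zharkov2020TropicalWeil, §2 (pp. 2–4)] -/
theorem one_add_I_pow_eight : ((1 : ℂ) + (1 : ℂ) * Complex.I) ^ (2 * 4) = 16 := by
  have h2 : ((1 : ℂ) + (1 : ℂ) * Complex.I) ^ 2 = 2 * Complex.I := by
    have hI : Complex.I * Complex.I = -1 := Complex.I_mul_I
    linear_combination (1 : ℂ) * hI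
  have h4 : ((2 : ℂ) * Complex.I) ^ 2 = -4 := by
    have hI : Complex.I * Complex.I = -1 := Complex.I_mul_I
    linear_combination (4 : ℂ) * hI
  rw [show 2 * 4 = 2 * 2 * 2 by norm_num, pow_mul, pow_mul, h2, h4]
  norm_num

/-! ## §2 Three classes separated by `Ŵ` and `M̂` -/

/-- **An isogeny tower has independent classes.** Effective tropical 4-cycles `Z₀, Z₁, Z₂` on one torus with
`W(Z₁) = λ W(Z₀)`, `W(Z₂) = λ² W(Z₀)`, `μ(Z₁) = 625 μ(Z₀)`, `μ(Z₂) = 625² μ(Z₀)` (`λ = (2+i)⁸ = −527 − 336i`) and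
`W(Z₀) ≠ 0` have ℝ-linearly independent cycle classes: applying `Ŵ` and `M̂` to a real relation `Σ gⱼ[Zⱼ] = 0` gives
`(g₀ + λg₁ + λ²g₂)·W(Z₀) = 0` and `(g₀ + 625g₁ + 625²g₂)·μ(Z₀) = 0`; with `W(Z₀) ≠ 0` (hence `μ(Z₀) > 0` by the
calibration inequality `‖W‖ ≤ μ`) the imaginary part forces `g₁ = 1054 g₂`, the real part `g₀ = 390625 g₂`, and the
mass relation `1440000 g₂ = 0`. [cite: MikhalkinZharkov2014Eigenwave, Prop. 4.3 and Thm. 5.4] -/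
theorem linearIndependent_cyc_of_isogenyTower {Q : Matrix (Fin (2 * 4)) (Fin (2 * 4)) ℝ}
    (Z : Fin 3 → TropicalTorusCycle (2 * 4) 4 Q) (hW0 : weilFunctional (Z 0) ≠ 0)
    (hW1 : weilFunctional (Z 1) = (-527 - 336 * Complex.I) * weilFunctional (Z 0))
    (hW2 : weilFunctional (Z 2) = (164833 + 354144 * Complex.I) * weilFunctional (Z 0))
    (hμ1 : μ⟦4, Z 1⟧ = 625 * μ⟦4, Z 0⟧) (hμ2 : μ⟦4, Z 2⟧ = 390625 * μ⟦4, Z 0⟧) :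
    LinearIndependent ℝ fun j => (Z j).cyc := by
  -- positivity of the mass of `Z 0` from `W(Z 0) ≠ 0` and `‖W‖ ≤ μ`
  have hμ0 : 0 < μ⟦4, Z 0⟧ :=
    lt_of_lt_of_le (norm_pos_iff.2 hW0) (norm_weilFunctional_le_weilMass (Z 0))
  rw [Fintype.linearIndependent_iff]
  intro g hg
  have hfun : (fun S S' : Fin 4 → Fin (2 * 4) => ∑ i, g i * (Z i).cyc S S') = fun _ _ => 0 := by
    funext S S'
    have := congrFun (congrFun hg S) S'
    simpa [Finset.sum_apply, Pi.smul_apply, smul_eq_mul] using this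
  -- apply `Ŵ` and `M̂` to the relation
  have hW : ∑ i, ((g i : ℝ) : ℂ) * weilFunctional (Z i) = 0 := by
    rw [← weilPairing_sum_cyc Z g, hfun]
    simp
  have hM : ∑ i, g i * μ⟦4, Z i⟧ = 0 := by
    have h0 : ∑ i, ((g i : ℝ) : ℂ) * ((μ⟦4, Z i⟧ : ℝ) : ℂ) = 0 := by
      rw [← hermPairing_sum_cyc Z g, hfun]
      simp
    exact_mod_cast h0
  rw [Fin.sum_univ_three] at hW hM
  rw [hW1, hW2] at hW
  rw [hμ1, hμ2] at hM
  -- the complex relation `(g₀ + λ g₁ + λ² g₂) · W(Z 0) = 0`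
  have key : (((g 0 : ℝ) : ℂ) + ((g 1 : ℝ) : ℂ) * (-527 - 336 * Complex.I) +
      ((g 2 : ℝ) : ℂ) * (164833 + 354144 * Complex.I)) * weilFunctional (Z 0) = 0 := by
    linear_combination hW
  have key' : ((g 0 : ℝ) : ℂ) + ((g 1 : ℝ) : ℂ) * (-527 - 336 * Complex.I) +
      ((g 2 : ℝ) : ℂ) * (164833 + 354144 * Complex.I) = 0 := by
    rcases mul_eq_zero.1 key with h | h
    · exact h
    · exact absurd h hW0
  have him : -336 * g 1 + 354144 * g 2 = 0 := by
    have h := congrArg Complex.im key'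
    simp only [Complex.add_re, Complex.add_im, Complex.sub_re, Complex.sub_im, Complex.mul_re, Complex.mul_im,
      Complex.neg_re, Complex.neg_im, Complex.ofReal_re, Complex.ofReal_im, Complex.I_re, Complex.I_im,
      Complex.re_ofNat, Complex.im_ofNat, Complex.zero_im] at h
    linarith
  have hre : g 0 - 527 * g 1 + 164833 * g 2 = 0 := by
    have h := congrArg Complex.re key'
    simp only [Complex.add_re, Complex.add_im, Complex.sub_re, Complex.sub_im, Complex.mul_re, Complex.mul_im,
      Complex.neg_re, Complex.neg_im, Complex.ofReal_re, Complex.ofReal_im, Complex.I_re, Complex.I_im,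
      Complex.re_ofNat, Complex.im_ofNat, Complex.zero_re] at h
    linarith
  -- the mass relation `(g₀ + 625 g₁ + 390625 g₂) · μ(Z 0) = 0`
  have hmass : (g 0 + 625 * g 1 + 390625 * g 2) * μ⟦4, Z 0⟧ = 0 := by
    linear_combination hM
  have hsum : g 0 + 625 * g 1 + 390625 * g 2 = 0 := by
    rcases mul_eq_zero.1 hmass with h | h
    · exact h
    · exact absurd h hμ0.ne'
  have hg2 : g 2 = 0 := by linarith
  have hg1 : g 1 = 0 := by rw [hg2] at him; linarith
  have hg0 : g 0 = 0 := by rw [hg1, hg2] at hre; linarith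
  intro i
  fin_cases i
  · exact hg0
  · exact hg1
  · exact hg2

/-! ## §3 One cycle with `W ≠ 0` ⟹ three independent effective classes (any `Q` commuting with `J`) -/

/-- **Three independent effective classes from one.** For every real `8×8` matrix `Q` commuting with `J = weilJ 4`
and every effective tropical 4-cycle `Z` on `ℝ⁸/Q·ℤ⁸` with `W(Z) ≠ 0`, the cycles `Z`, `(2+J)_*Z`, `(2+J)_*(2+J)_*Z`
are effective tropical 4-cycles on the SAME torus with ℝ-linearly independent classes. No positivity or genericity
of `Q` is used. [cite: MikhalkinZharkov2014Eigenwave, Prop. 4.3] [cite: Zharkov2020TropicalWeil, §2 (pp. 2–4)] -/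
theorem exists_three_linearIndependent_cyc_of_weilFunctional_ne_zero {Q : Matrix (Fin (2 * 4)) (Fin (2 * 4)) ℝ}
    (hQJ : Q * weilJ 4 = weilJ 4 * Q) (Z : TropicalTorusCycle (2 * 4) 4 Q) (hW : weilFunctional Z ≠ 0) :
    ∃ c : Fin 3 → TropicalTorusCycle (2 * 4) 4 Q, c 0 = Z ∧ LinearIndependent ℝ fun j => (c j).cyc := by
  obtain ⟨Z₁, -, -, hW₁, hμ₁⟩ := exists_endomorphism_transport hQJ Z 2 1 (Or.inl two_ne_zero)
  obtain ⟨Z₂, -, -, hW₂, hμ₂⟩ := exists_endomorphism_transport hQJ Z₁ 2 1 (Or.inl two_ne_zero)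
  have hlam : (((2 : ℤ) : ℂ) + ((1 : ℤ) : ℂ) * Complex.I) ^ (2 * 4) = -527 - 336 * Complex.I := by
    have : (((2 : ℤ) : ℂ) + ((1 : ℤ) : ℂ) * Complex.I) = (2 : ℂ) + (1 : ℂ) * Complex.I := by norm_num
    rw [this, two_add_I_pow_eight]
  have h625 : (((2 : ℤ) : ℝ) ^ 2 + ((1 : ℤ) : ℝ) ^ 2) ^ 4 = 625 := by norm_num
  rw [hlam] at hW₁ hW₂
  rw [h625] at hμ₁ hμ₂
  refine ⟨![Z, Z₁, Z₂], rfl, ?_⟩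
  refine linearIndependent_cyc_of_isogenyTower ![Z, Z₁, Z₂] ?_ ?_ ?_ ?_ ?_
  · show weilFunctional Z ≠ 0
    exact hW
  · show weilFunctional Z₁ = (-527 - 336 * Complex.I) * weilFunctional Z
    exact hW₁
  · show weilFunctional Z₂ = (164833 + 354144 * Complex.I) * weilFunctional Z
    rw [hW₂, hW₁, ← mul_assoc, ← sq, lambda_sq]
  · show μ⟦4, Z₁⟧ = 625 * μ⟦4, Z⟧
    exact hμ₁
  · show μ⟦4, Z₂⟧ = 390625 * μ⟦4, Z⟧
    rw [hμ₂, hμ₁]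
    ring

/-- The ℚ-linear version (ℝ-independence of real-valued functions implies ℚ-independence).
[cite: MikhalkinZharkov2014Eigenwave, Prop. 4.3] -/
theorem exists_three_linearIndependent_rat_cyc_of_weilFunctional_ne_zero
    {Q : Matrix (Fin (2 * 4)) (Fin (2 * 4)) ℝ}
    (hQJ : Q * weilJ 4 = weilJ 4 * Q) (Z : TropicalTorusCycle (2 * 4) 4 Q) (hW : weilFunctional Z ≠ 0) :
    ∃ c : Fin 3 → TropicalTorusCycle (2 * 4) 4 Q, c 0 = Z ∧ LinearIndependent ℚ fun j => (c j).cyc := by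
  obtain ⟨c, hc, hli⟩ := exists_three_linearIndependent_cyc_of_weilFunctional_ne_zero hQJ Z hW
  exact ⟨c, hc, hli.restrict_scalars' ℚ⟩

/-! ## §4 K1 ⟺ "no three independent effective classes" -/

/-- **K1 ⟺ no three ℚ-independent effective tropical (4,4)-classes on any very general tropical Weil eightfold.**
(⟹) K1 gives `W = 0` for all three cycles and the PROVED crux K3 (`TropicalHodgeBound.tropicalHodgeBound_proof`,
p322554) says three cycles with `W = 0` are ℚ-dependent; (⟸) one cycle with `W ≠ 0` produces three independent
ones by `exists_three_linearIndependent_rat_cyc_of_weilFunctional_ne_zero`. So the weakest tropical hypothesis the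
route's assembly could use in place of K1 ("fewer than three independent effective classes") IS K1, and at a
Weil-generic period the number of ℚ-independent effective classes is `1` or `3`, never `2`.
[cite: Zharkov2020TropicalWeil, §2 (pp. 2–4)] [cite: MikhalkinZharkov2014Eigenwave, Thm. 5.4] -/
theorem tropicalWeilVanishing_iff_no_three_linearIndependent :
    Summit.HodgeConjecture.HodgeConjecture.Theses.TropicalWeilObstruction.TropicalWeilVanishing ↔
      ∀ Q : Matrix (Fin (2 * 4)) (Fin (2 * 4)) ℝ, Q.PosDef → Q * weilJ 4 = weilJ 4 * Q → IsWeilGeneric 4 Q →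
        ∀ c : Fin 3 → TropicalTorusCycle (2 * 4) 4 Q, ¬ LinearIndependent ℚ fun j => (c j).cyc := by
  constructor
  · intro hK1 Q hQ hJ hG c
    exact TropicalHodgeBound.tropicalHodgeBound_proof Q hQ hJ hG c fun j => hK1 Q hQ hJ hG (c j)
  · intro h Q hQ hJ hG Z
    by_contra hW
    obtain ⟨c, -, hli⟩ := exists_three_linearIndependent_rat_cyc_of_weilFunctional_ne_zero hJ Z hW
    exact h Q hQ hJ hG c hli

/-- **Dichotomy form.** At every positive definite, `J`-commuting, Weil-generic period: EITHER every effective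
tropical 4-cycle has `W = 0` (K1 holds at `Q`; then any three effective classes are ℚ-dependent, by K3), OR there
are three effective tropical 4-cycles with ℚ-linearly independent classes (which, by K3's coordinates, span the whole
rational tropical Hodge space `⟨θ₄, Re w, Im w⟩_ℚ`). [cite: MikhalkinZharkov2014Eigenwave, Thm. 5.4] -/
theorem weilFunctional_eq_zero_or_exists_three_linearIndependent {Q : Matrix (Fin (2 * 4)) (Fin (2 * 4)) ℝ}
    (hQ : Q.PosDef) (hJ : Q * weilJ 4 = weilJ 4 * Q) (hG : IsWeilGeneric 4 Q) :
    ((∀ Z : TropicalTorusCycle (2 * 4) 4 Q, weilFunctional Z = 0) ∧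
        ∀ c : Fin 3 → TropicalTorusCycle (2 * 4) 4 Q, ¬ LinearIndependent ℚ fun j => (c j).cyc) ∨
      ∃ c : Fin 3 → TropicalTorusCycle (2 * 4) 4 Q, LinearIndependent ℚ fun j => (c j).cyc := by
  by_cases hall : ∀ Z : TropicalTorusCycle (2 * 4) 4 Q, weilFunctional Z = 0
  · exact Or.inl ⟨hall, fun c => TropicalHodgeBound.tropicalHodgeBound_proof Q hQ hJ hG c fun j => hall (c j)⟩
  · obtain ⟨Z, hZ⟩ := not_forall.1 hall
    obtain ⟨c, -, hli⟩ := exists_three_linearIndependent_rat_cyc_of_weilFunctional_ne_zero hJ Z hZ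
    exact Or.inr ⟨c, hli⟩

end Summit.HodgeConjecture.HodgeConjecture.Theorems.TropicalWeilVanishing.Phases

end
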